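import Summits.BirchSwinnertonDyer.BirchSwinnertonDyer.Theorems.ByReductionTypeAtTwoOrdKatoHalfAtTwoIsoIotaNegDiscNecessity
import Summits.BirchSwinnertonDyer.BirchSwinnertonDyer.Theorems.ByReductionTypeAtTwoOrdKatoHalfAtTwoIsoMuFreeValueChoiceFree
import Literature.NumberTheory.EllipticCurves.Kato2004.OrdinaryKernelFunctionalOfPoitouTateProofs
import HarnessLib

/-!
# Route ByReductionTypeAtTwo, crux `OrdKatoHalfAtTwoIso` (stmt-BirchSwinnertonDyer-19573), line `steinberg-fibre-at-two`,
# F1 slot (child stmt-BirchSwinnertonDyer-24097): the `Δ < 0` doors RE-KEYED — the cite stub `stub_ordKernelFunctional` (p727215) FED from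
# {Poitou–Tate exactness p729889, «ordinary quotient torsion-free of rank one» p740652}; the print fact (12.2.3) LEAVES the F1 lane

Seat `cruxlead-stmt-BirchSwinnertonDyer-19573-w3` g10 (prover WIDTH; LEAD lineage SUMMON-only; HOME `run/shared/lean/pub/bsd-2adic/`;
`--supports` stmt-BirchSwinnertonDyer-24097).  THEOREMS ONLY (no definition, no named fact, no `sorry`, no instance).  HONEST FRAMING (cell
bsd-2adic): BSD is not proved by any of this; nothing is closed; the research content of the F1 slot (G11⁺, G11⁻, N2D⁻ / MU13⁻) is untouched;
every theorem below is CONDITIONAL on the named facts and memo texts displayed in its signature.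

WHY.  The `Δ < 0` kernel doors of the line (w3 g5–g9: p727801, p736704, p737300, p738787, p741745, p741839) take the cite stub
`(hOK : Kato2004.exists_ordinaryKernelFunctional)` next to `(hPT : Kato2004.exists_lambdaAdicLocalTatePairing_poitouTate_exact)`; w3 g8 (p741408)
derived `hOK` from the structure fact `hQ : localIwasawaH1_ordinaryQuotient_isTorsionFree_rank_eq_one` AND the finite-generation fact (12.2.3)
`localIwasawaH1_tateRep_moduleFinite` (audit: XL, no owner).  This seat's Literature theorem
`Kato2004.exists_ordinaryKernelFunctional_of_poitouTate_of_ordinaryQuotientRank : hPT → hQ → exists_ordinaryKernelFunctional` (companion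
`Kato2004/OrdinaryKernelFunctionalOfPoitouTateProofs.lean`: the ordinary quotient is FINITELY GENERATED because the transpose of the `Λ`-adic Tate
pairing embeds the coarse quotient `ι`-semilinearly into `X(E/ℚ_∞)` with kernel `range F⁺ ⊔ loc 𝐇¹_Γ` — clauses (E)(I)(R) — and `X(E/ℚ_∞)`, `𝐇¹_Γ(T_pW)`
are finitely generated by KERNEL theorems) makes `hOK` a consequence of the door's OWN `hPT` plus `hQ`.  This file records the re-keyed doors
(one application each; no proof content of its own):

* §1 `iotaNegDisc_iff_greenbergMuNeg_and_notTwoDivisible_of_structureFact (hPT) (hQ) (h12) (hPub)` : F1μι⁻ ⟺ G11⁻ ∧ N2D⁻;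
  `…_and_zetaQuotientMu_of_structureFact` : F1μι⁻ ⟺ G11⁻ ∧ MU13⁻; `muFreeValue_negDisc_iff_greenbergMuNeg_and_zetaQuotientMu_of_structureFact` :
  V♭⁻ ⟺ G11⁻ ∧ MU13⁻; `zetaColemanMuIotaNegDiscAtTwo_of_poitouTate_of_structureFact_of_muFreeValue` : {hPT, hQ, V♭⁻} ⟹ F1μι⁻;
  `zetaColemanMuIotaNegDiscAtTwo_of_greenbergMuNeg_of_zetaQuotientMu_of_structureFact` : {hPT, hQ, PUB, G11⁻, MU13⁻} ⟹ F1μι⁻.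
* §2 **`ordKatoFineZetaAtTwoResidue_iff_greenbergMu_both_and_notTwoDivisible_of_structureFact (hPT) (hQ) (h12) (hPub) (hCassels) (hAU)` :
  child 24097 ⟺ G11⁺ ∧ G11⁻ ∧ N2D⁻** — p741745's kernel `iff` with the binder set {hPT, hOK ⟸ (12.2.3)+hQ, h12, PUB, Cassels, AU} replaced by
  {hPT, hQ, h12, PUB, Cassels, AU}; `ordKatoFineZetaAtTwoResidue_of_greenbergMu_both_of_notTwoDivisible_of_structureFact` (the (⟸) half BY NAME).
* §3 `muFreeValue_negDisc_iff_exists_of_poitouTate_of_structureFact (hPT) (hQ)` : V♭⁻ ⟺ V⁻ (p741839's choice-freeness of the value text,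
  re-keyed from {(12.2.3), hQ} to {hPT, hQ}).
SKELETON CONSEQUENCE (the LEAD's call, not executed here): `stub_ordKernelFunctional := Kato2004.exists_ordinaryKernelFunctional_of_poitouTate_of_…
  stub_PT stub_Q` with two CITE stubs `stub_PT : exists_lambdaAdicLocalTatePairing_poitouTate_exact` (which also yields `stub_tateDualityTower` by
  `exists_lambdaAdicLocalTatePairing_selmer_orthogonal_of_poitouTate_exact`) and `stub_Q : localIwasawaH1_ordinaryQuotient_isTorsionFree_rank_eq_one` —
  same stub count, both audit-PASS print facts, (12.2.3) off the price sheet.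

References: [Kato2004Asterisque] §17.13 (17.13.1)–(17.13.2) (p. 279), Prop. 17.11 (p. 277), Thm. 12.4 (p. 221), Thm. 12.6 (p. 222), Thm. 17.4 (p. 273);
[GreenbergLNM1716] Conj. 1.11 (p. 64), §4 pp. 121–122; [PerrinRiou2000JAMS] §1.1; [MilneADT2006] I Thm. 4.10, I.7.3; [AbbesUllmo1996] Thm. A;
tree p727215, p729889, p740652, p741408, p741745, p741839 and this seat's `Kato2004/OrdinaryKernelFunctionalOfPoitouTateProofs.lean`.
-/

set_option autoImplicit false
set_option linter.dupNamespace false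

noncomputable section

open scoped Classical MatrixGroups ModularForm NumberField
open CongruenceSubgroup WeierstrassCurve Field IsDedekindDomain NumberField
open Literature.NumberTheory.GaloisRepresentations
open Literature.NumberTheory.GaloisCohomology
open Literature.NumberTheory.EllipticCurves Literature.NumberTheory.EllipticCurves.ModularForms
  Literature.NumberTheory.EllipticCurves.GreenbergSelmer
open Literature.NumberTheory.EllipticCurves.Kato2004
  Literature.NumberTheory.EllipticCurves.Kato2004.EulerSystemValues
open Literature.NumberTheory.EllipticCurves.IwasawaDual
open Literature.NumberTheory.EllipticCurves.Rank1Residual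
open Literature.NumberTheory.EllipticCurves.Greenberg1999
open Summit.BirchSwinnertonDyer.Rank1Residual Summit.BirchSwinnertonDyer.Rank1Residual.X5
open Summit.BirchSwinnertonDyer.BirchSwinnertonDyer.Theses.ByReductionTypeAtTwo

namespace Summit.BirchSwinnertonDyer.BirchSwinnertonDyer.Theorems.SteinbergFibreAtTwo

/-! ## §1 The `Δ < 0` conjunct F1μι⁻ and its memo currencies, keyed by {hPT, hQ} -/

/-- **F1μι⁻ ⟺ G11⁻ ∧ N2D⁻ modulo {Poitou–Tate exactness, the structure fact, `thm12_4`, PUB}** — p741745's `iotaNegDisc_iff_greenbergMuNeg_and_notTwoDivisible`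
with the cite stub `hOK` FED from `hPT` + `hQ` (`Kato2004.exists_ordinaryKernelFunctional_of_poitouTate_of_ordinaryQuotientRank`).  Neither side is proved.
[cite: GreenbergLNM1716, Conj. 1.11 (p. 64)] [cite: Kato2004Asterisque, Thm. 12.4 (2)(3) (p. 221), Prop. 17.11 (p. 277), §17.13 (pp. 279–280)] -/
theorem iotaNegDisc_iff_greenbergMuNeg_and_notTwoDivisible_of_structureFact (hPT : exists_lambdaAdicLocalTatePairing_poitouTate_exact)
    (hQ : localIwasawaH1_ordinaryQuotient_isTorsionFree_rank_eq_one) (h12 : thm12_4) (hPub : OrdPublishedInputsAtTwo) :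
    ZetaColemanMuIotaNegDiscAtTwo ↔ (GreenbergMuZeroTwoOrdNegDisc ∧ ZetaNotTwoDivisibleTwoOrdNegDisc) :=
  iotaNegDisc_iff_greenbergMuNeg_and_notTwoDivisible hPT (exists_ordinaryKernelFunctional_of_poitouTate_of_ordinaryQuotientRank hPT hQ) h12 hPub

/-- **F1μι⁻ ⟺ G11⁻ ∧ MU13⁻ modulo {hPT, hQ, `thm12_4`, PUB}** (the zeta-quotient currency; p741745's `…_and_zetaQuotientMu` re-keyed).
[cite: GreenbergLNM1716, Conj. 1.11 (p. 64)] [cite: Kato2004Asterisque, Thm. 12.4 (2)(3) (p. 221), §17.13 (pp. 279–280)] -/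
theorem iotaNegDisc_iff_greenbergMuNeg_and_zetaQuotientMu_of_structureFact (hPT : exists_lambdaAdicLocalTatePairing_poitouTate_exact)
    (hQ : localIwasawaH1_ordinaryQuotient_isTorsionFree_rank_eq_one) (h12 : thm12_4) (hPub : OrdPublishedInputsAtTwo) :
    ZetaColemanMuIotaNegDiscAtTwo ↔ (GreenbergMuZeroTwoOrdNegDisc ∧ ZetaQuotientMuZeroTwoOrdNegDisc) :=
  iotaNegDisc_iff_greenbergMuNeg_and_zetaQuotientMu hPT (exists_ordinaryKernelFunctional_of_poitouTate_of_ordinaryQuotientRank hPT hQ) h12 hPub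

/-- **V♭⁻ ⟺ G11⁻ ∧ MU13⁻ modulo {hPT, hQ, `thm12_4`, PUB}** — w3 g7's LOSSLESS SPLIT `muFreeValue_negDisc_iff_greenbergMuNeg_and_zetaQuotientMu` (p737300)
with `hOK` fed from `hPT` + `hQ`.  Neither side is proved; nothing asserted.
[cite: GreenbergLNM1716, Conj. 1.11 (p. 64)] [cite: Kato2004Asterisque, Thm. 12.4 (2) (p. 221), Prop. 17.11 (p. 277), §17.13 (pp. 279–280)] -/
theorem muFreeValue_negDisc_iff_greenbergMuNeg_and_zetaQuotientMu_of_structureFact (hPT : exists_lambdaAdicLocalTatePairing_poitouTate_exact)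
    (hQ : localIwasawaH1_ordinaryQuotient_isTorsionFree_rank_eq_one) (h12 : thm12_4) (hPub : OrdPublishedInputsAtTwo) :
    (∀ (W : WeierstrassCurve ℚ) [W.IsElliptic] [W.IsGloballyMinimal]
      [ContinuousSMul ℤ_[2] (W.tateModule 2)] [Module.Free ℤ_[2] (W.tateModule 2)] [Module.Finite ℤ_[2] (W.tateModule 2)]
      {N : ℕ} [NeZero N] (f : CuspForm (Gamma0 N) 2)
      (κ : ZpExtension ℚ 2) (γ : absoluteGaloisGroup ℚ) (hκ : κ.IsCyclotomic) (hγ : κ.IsTopGenerator γ),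
      W.Δ < 0 → IsOrdinaryAt W 2 → W.HasSurjectiveModNGaloisRep 2 → IsCyclotomicVariable 2 γ → IsNewformOf W f →
      ∀ (v₂ : HeightOneSpectrum (𝓞 ℚ)) (_ : ((2 : ℕ) : 𝓞 ℚ) ∈ v₂.asIdeal)
        (γᵥ : absoluteGaloisGroup (v₂.adicCompletion ℚ))
        (hsurj : Function.Surjective
          (κ.toContinuousMonoidHom.comp (resGalOfEmb (closureEmb (K := ℚ) (v₂.adicCompletion ℚ)))))
        (hγᵥ : κ.IsTopGenerator (resGalOfEmb (closureEmb (K := ℚ) (v₂.adicCompletion ℚ)) γᵥ))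
        (I : IwasawaH1Data W 2 κ γ) (J : LocalIwasawaH1Data κ v₂ ((tateRep W 2).toLocal v₂) γᵥ)
        (J' : LocalIwasawaH1Data κ v₂ (tateLocalOrdinaryRep W 2 v₂) γᵥ)
        (col : J.H →ₗ[IwasawaAlgebra 2] IwasawaAlgebra 2),
        (∀ x : J.H, col x = 0 ↔ x ∈ LinearMap.range (J'.ordinaryInclusion J)) →
        (∃ x : J.H, col x ∉ IwasawaAlgebra.augIdealP 2) →
        ∃ g : I.H, IsEulerSystemClassTwo W hκ I g ∧ col (I.loc J hsurj hγ hγᵥ g) ∉ IwasawaAlgebra.augIdealP 2) ↔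
    (GreenbergMuZeroTwoOrdNegDisc ∧ ZetaQuotientMuZeroTwoOrdNegDisc) :=
  muFreeValue_negDisc_iff_greenbergMuNeg_and_zetaQuotientMu hPT
    (exists_ordinaryKernelFunctional_of_poitouTate_of_ordinaryQuotientRank hPT hQ) h12 hPub

/-- **F1μι⁻ = `ZetaColemanMuIotaNegDiscAtTwo` BY NAME from {hPT, hQ, V♭⁻}** — w3 g5's p727801 `zetaColemanMuIotaNegDiscAtTwo_of_tateDuality_of_ordKernel_of_muFreeValue`
with Tate duality projected from `hPT` and `hOK` fed from `hPT` + `hQ`: the registered `Δ < 0` stubs V♭⁻ + two CITE facts give conjunct 1 of child 24097,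
(12.2.3) NOT among them.  CONDITIONAL on the displayed texts; nothing closed.
[cite: MilneADT2006, Ch. I Cor. 2.3 and Thm. 4.10] [cite: PerrinRiou2000JAMS, §1.1 (p. 537)] [cite: Kato2004Asterisque, Thm 12.6 (p. 222), Prop. 17.11 (p. 277), §17.13 (pp. 279–280)] -/
theorem zetaColemanMuIotaNegDiscAtTwo_of_poitouTate_of_structureFact_of_muFreeValue
    (hPT : exists_lambdaAdicLocalTatePairing_poitouTate_exact) (hQ : localIwasawaH1_ordinaryQuotient_isTorsionFree_rank_eq_one)
    (hVflat : ∀ (W : WeierstrassCurve ℚ) [W.IsElliptic] [W.IsGloballyMinimal]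
      [ContinuousSMul ℤ_[2] (W.tateModule 2)] [Module.Free ℤ_[2] (W.tateModule 2)] [Module.Finite ℤ_[2] (W.tateModule 2)]
      {N : ℕ} [NeZero N] (f : CuspForm (Gamma0 N) 2)
      (κ : ZpExtension ℚ 2) (γ : absoluteGaloisGroup ℚ) (hκ : κ.IsCyclotomic) (hγ : κ.IsTopGenerator γ),
      W.Δ < 0 → IsOrdinaryAt W 2 → W.HasSurjectiveModNGaloisRep 2 → IsCyclotomicVariable 2 γ → IsNewformOf W f →
      ∀ (v₂ : HeightOneSpectrum (𝓞 ℚ)) (_ : ((2 : ℕ) : 𝓞 ℚ) ∈ v₂.asIdeal)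
        (γᵥ : absoluteGaloisGroup (v₂.adicCompletion ℚ))
        (hsurj : Function.Surjective
          (κ.toContinuousMonoidHom.comp (resGalOfEmb (closureEmb (K := ℚ) (v₂.adicCompletion ℚ)))))
        (hγᵥ : κ.IsTopGenerator (resGalOfEmb (closureEmb (K := ℚ) (v₂.adicCompletion ℚ)) γᵥ))
        (I : IwasawaH1Data W 2 κ γ) (J : LocalIwasawaH1Data κ v₂ ((tateRep W 2).toLocal v₂) γᵥ)
        (J' : LocalIwasawaH1Data κ v₂ (tateLocalOrdinaryRep W 2 v₂) γᵥ)
        (col : J.H →ₗ[IwasawaAlgebra 2] IwasawaAlgebra 2),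
        (∀ x : J.H, col x = 0 ↔ x ∈ LinearMap.range (J'.ordinaryInclusion J)) →
        (∃ x : J.H, col x ∉ IwasawaAlgebra.augIdealP 2) →
        ∃ g : I.H, IsEulerSystemClassTwo W hκ I g ∧ col (I.loc J hsurj hγ hγᵥ g) ∉ IwasawaAlgebra.augIdealP 2) :
    ZetaColemanMuIotaNegDiscAtTwo :=
  zetaColemanMuIotaNegDiscAtTwo_of_tateDuality_of_ordKernel_of_muFreeValue
    (exists_lambdaAdicLocalTatePairing_selmer_orthogonal_of_poitouTate_exact hPT)
    (exists_ordinaryKernelFunctional_of_poitouTate_of_ordinaryQuotientRank hPT hQ) hVflat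

/-- **F1μι⁻ BY NAME from {hPT, hQ, PUB, G11⁻, MU13⁻}** — w3 g7's `zetaColemanMuIotaNegDiscAtTwo_of_greenbergMuNeg_of_zetaQuotientMu` with `hOK` fed from
`hPT` + `hQ`.  CONDITIONAL on the displayed OPEN statements; nothing closed.
[cite: GreenbergLNM1716, Conj. 1.11 (p. 64)] [cite: Kato2004Asterisque, Thm. 12.6 (p. 222), Prop. 17.11 (p. 277), §17.13 (pp. 279–280)] -/
theorem zetaColemanMuIotaNegDiscAtTwo_of_greenbergMuNeg_of_zetaQuotientMu_of_structureFact
    (hPT : exists_lambdaAdicLocalTatePairing_poitouTate_exact) (hQ : localIwasawaH1_ordinaryQuotient_isTorsionFree_rank_eq_one)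
    (hPub : OrdPublishedInputsAtTwo) (hG : GreenbergMuZeroTwoOrdNegDisc) (hZ : ZetaQuotientMuZeroTwoOrdNegDisc) :
    ZetaColemanMuIotaNegDiscAtTwo :=
  zetaColemanMuIotaNegDiscAtTwo_of_greenbergMuNeg_of_zetaQuotientMu hPT
    (exists_ordinaryKernelFunctional_of_poitouTate_of_ordinaryQuotientRank hPT hQ) hPub hG hZ

/-! ## §2 The whole child 24097, keyed by {hPT, hQ, thm12_4, PUB, Cassels, Abbes–Ullmo} -/

/-- **The PAIR child `OrdKatoFineZetaAtTwoResidue` (stmt-BirchSwinnertonDyer-24097) ⟺ G11⁺ ∧ G11⁻ ∧ N2D⁻, kernel `iff` modulo print BY NAME with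
(12.2.3) OFF the binder list** — p741745's `ordKatoFineZetaAtTwoResidue_iff_greenbergMu_both_and_notTwoDivisible` with the cite stub `hOK` FED from
`hPT` + `hQ`.  Binders: Poitou–Tate exactness (p729889), the structure fact (p740652), `thm12_4`, PUB, Cassels, Abbes–Ullmo — all print; the right-hand
side is Greenberg's Conjecture 1.11 at `2` on both onto cells + the `2`-indivisibility of Kato's Euler system on `Δ < 0`.  Neither side is proved.
[cite: GreenbergLNM1716, Conj. 1.11 (p. 64)] [cite: Kato2004Asterisque, Thm. 12.6 (p. 222), Thm. 17.4 (1)(2) (p. 273), Prop. 17.11 (p. 277), §17.13 (pp. 279–280)]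
[cite: AbbesUllmo1996, Thm. A] [cite: MilneADT2006, Thm. I.7.3 (Cassels)] -/
theorem ordKatoFineZetaAtTwoResidue_iff_greenbergMu_both_and_notTwoDivisible_of_structureFact
    (hPT : exists_lambdaAdicLocalTatePairing_poitouTate_exact) (hQ : localIwasawaH1_ordinaryQuotient_isTorsionFree_rank_eq_one)
    (h12 : thm12_4) (hPub : OrdPublishedInputsAtTwo) (hCassels : bsdRHS_eq_of_isIsogenous)
    (hAU : abbesUllmo_not_dvd_maninConstant_of_not_dvd_level) :
    OrdKatoFineZetaAtTwoResidue ↔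
      (GreenbergMuZeroTwoOrdPosDisc ∧ GreenbergMuZeroTwoOrdNegDisc ∧ ZetaNotTwoDivisibleTwoOrdNegDisc) :=
  ordKatoFineZetaAtTwoResidue_iff_greenbergMu_both_and_notTwoDivisible hPT
    (exists_ordinaryKernelFunctional_of_poitouTate_of_ordinaryQuotientRank hPT hQ) h12 hPub hCassels hAU

/-- **The child from the three displayed statements BY NAME, keyed by {hPT, hQ, thm12_4, PUB, Abbes–Ullmo}** (the (⟸) half of §2 for the skeleton:
G11⁺, G11⁻, N2D⁻ + print ⟹ 24097).  CONDITIONAL on the displayed OPEN statements; the item is NOT closed by this.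
[cite: GreenbergLNM1716, Conj. 1.11 (p. 64)] [cite: Kato2004Asterisque, Thm. 12.4 (2)(3) (p. 221), Thm. 17.4 (1)(2) (p. 273), §17.13 (pp. 279–280)] [cite: AbbesUllmo1996, Thm. A] -/
theorem ordKatoFineZetaAtTwoResidue_of_greenbergMu_both_of_notTwoDivisible_of_structureFact
    (hPT : exists_lambdaAdicLocalTatePairing_poitouTate_exact) (hQ : localIwasawaH1_ordinaryQuotient_isTorsionFree_rank_eq_one)
    (h12 : thm12_4) (hPub : OrdPublishedInputsAtTwo) (hAU : abbesUllmo_not_dvd_maninConstant_of_not_dvd_level)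
    (hGp : GreenbergMuZeroTwoOrdPosDisc) (hG : GreenbergMuZeroTwoOrdNegDisc) (hN : ZetaNotTwoDivisibleTwoOrdNegDisc) :
    OrdKatoFineZetaAtTwoResidue :=
  ordKatoFineZetaAtTwoResidue_of_greenbergMu_both_of_notTwoDivisible hPT
    (exists_ordinaryKernelFunctional_of_poitouTate_of_ordinaryQuotientRank hPT hQ) h12 hPub hAU hGp hG hN

/-! ## §3 The value text is choice-free, keyed by {hPT, hQ}: V♭⁻ ⟺ V⁻ -/

/-- **V♭⁻ ⟺ V⁻ modulo {Poitou–Tate exactness, the structure fact}** (`Δ < 0`) — p741839's `muFreeValue_negDisc_iff_exists_of_ordinaryQuotientRank`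
re-keyed from {(12.2.3), hQ} to {hPT, hQ}: (⟹) instantiate the `∀ col` text at the normalised exact-kernel functional that EXISTS
(`Kato2004.exists_ordinaryKernelFunctional_of_poitouTate_of_ordinaryQuotientRank`, through `muFreeValue_negDisc_of_ordKernel`); (⟸) two functionals with kernel
inside the ordinary classes and a value outside `(2)` take `μ`-free values at the same classes
(`Kato2004.ordinaryKernelFunctional_notMem_iff_of_ker_le_of_poitouTate_of_ordinaryQuotientRank`).  CONDITIONAL on the two facts.
[cite: Kato2004Asterisque, Prop. 17.11 with proof (p. 277), 13.14 (p. 234), §17.13 (17.13.1) (p. 279)] [cite: BourbakiAC5to7, Ch. VII §4 nos. 1–2] -/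
theorem muFreeValue_negDisc_iff_exists_of_poitouTate_of_structureFact
    (hPT : exists_lambdaAdicLocalTatePairing_poitouTate_exact) (hQ : localIwasawaH1_ordinaryQuotient_isTorsionFree_rank_eq_one) :
    (∀ (W : WeierstrassCurve ℚ) [W.IsElliptic] [W.IsGloballyMinimal]
      [ContinuousSMul ℤ_[2] (W.tateModule 2)] [Module.Free ℤ_[2] (W.tateModule 2)] [Module.Finite ℤ_[2] (W.tateModule 2)]
      {N : ℕ} [NeZero N] (f : CuspForm (Gamma0 N) 2)
      (κ : ZpExtension ℚ 2) (γ : absoluteGaloisGroup ℚ) (hκ : κ.IsCyclotomic) (hγ : κ.IsTopGenerator γ),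
      W.Δ < 0 → IsOrdinaryAt W 2 → W.HasSurjectiveModNGaloisRep 2 → IsCyclotomicVariable 2 γ → IsNewformOf W f →
      ∀ (v₂ : HeightOneSpectrum (𝓞 ℚ)) (_ : ((2 : ℕ) : 𝓞 ℚ) ∈ v₂.asIdeal)
        (γᵥ : absoluteGaloisGroup (v₂.adicCompletion ℚ))
        (hsurj : Function.Surjective
          (κ.toContinuousMonoidHom.comp (resGalOfEmb (closureEmb (K := ℚ) (v₂.adicCompletion ℚ)))))
        (hγᵥ : κ.IsTopGenerator (resGalOfEmb (closureEmb (K := ℚ) (v₂.adicCompletion ℚ)) γᵥ))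
        (I : IwasawaH1Data W 2 κ γ) (J : LocalIwasawaH1Data κ v₂ ((tateRep W 2).toLocal v₂) γᵥ)
        (J' : LocalIwasawaH1Data κ v₂ (tateLocalOrdinaryRep W 2 v₂) γᵥ)
        (col : J.H →ₗ[IwasawaAlgebra 2] IwasawaAlgebra 2),
        (∀ x : J.H, col x = 0 ↔ x ∈ LinearMap.range (J'.ordinaryInclusion J)) →
        (∃ x : J.H, col x ∉ IwasawaAlgebra.augIdealP 2) →
        ∃ g : I.H, IsEulerSystemClassTwo W hκ I g ∧ col (I.loc J hsurj hγ hγᵥ g) ∉ IwasawaAlgebra.augIdealP 2) ↔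
    (∀ (W : WeierstrassCurve ℚ) [W.IsElliptic] [W.IsGloballyMinimal]
      [ContinuousSMul ℤ_[2] (W.tateModule 2)] [Module.Free ℤ_[2] (W.tateModule 2)] [Module.Finite ℤ_[2] (W.tateModule 2)]
      {N : ℕ} [NeZero N] (f : CuspForm (Gamma0 N) 2)
      (κ : ZpExtension ℚ 2) (γ : absoluteGaloisGroup ℚ) (hκ : κ.IsCyclotomic) (hγ : κ.IsTopGenerator γ),
      W.Δ < 0 → IsOrdinaryAt W 2 → W.HasSurjectiveModNGaloisRep 2 → IsCyclotomicVariable 2 γ → IsNewformOf W f →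
      ∀ (v₂ : HeightOneSpectrum (𝓞 ℚ)) (_ : ((2 : ℕ) : 𝓞 ℚ) ∈ v₂.asIdeal)
        (γᵥ : absoluteGaloisGroup (v₂.adicCompletion ℚ))
        (hsurj : Function.Surjective
          (κ.toContinuousMonoidHom.comp (resGalOfEmb (closureEmb (K := ℚ) (v₂.adicCompletion ℚ)))))
        (hγᵥ : κ.IsTopGenerator (resGalOfEmb (closureEmb (K := ℚ) (v₂.adicCompletion ℚ)) γᵥ))
        (I : IwasawaH1Data W 2 κ γ) (J : LocalIwasawaH1Data κ v₂ ((tateRep W 2).toLocal v₂) γᵥ)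
        (J' : LocalIwasawaH1Data κ v₂ (tateLocalOrdinaryRep W 2 v₂) γᵥ),
      ∃ col : J.H →ₗ[IwasawaAlgebra 2] IwasawaAlgebra 2,
        (∀ x : J.H, col x = 0 → x ∈ LinearMap.range (J'.ordinaryInclusion J)) ∧
        ∃ g : I.H, IsEulerSystemClassTwo W hκ I g ∧ col (I.loc J hsurj hγ hγᵥ g) ∉ IwasawaAlgebra.augIdealP 2) := by
  refine ⟨fun hVflat => muFreeValue_negDisc_of_ordKernel
      (exists_ordinaryKernelFunctional_of_poitouTate_of_ordinaryQuotientRank hPT hQ) hVflat, fun hV => ?_⟩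
  intro W _ _ _ _ _ N _ f κ γ hκ hγ hΔ hord h2 hγ' hf v₂ hv₂ γᵥ hsurj hγᵥ I J J' col hker hnorm
  obtain ⟨col₀, hker₀, g, hg, hval₀⟩ := hV W f κ γ hκ hγ hΔ hord h2 hγ' hf v₂ hv₂ γᵥ hsurj hγᵥ I J J'
  refine ⟨g, hg, ?_⟩
  exact (ordinaryKernelFunctional_notMem_iff_of_ker_le_of_poitouTate_of_ordinaryQuotientRank hPT hQ W hκ hv₂ hord hγᵥ
    J J' col col₀ (fun x hx => (hker x).mp hx) hnorm hker₀ ⟨_, hval₀⟩ (I.loc J hsurj hγ hγᵥ g)).mpr hval₀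

end Summit.BirchSwinnertonDyer.BirchSwinnertonDyer.Theorems.SteinbergFibreAtTwo

end
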